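import Mathlib
import HarnessLib
import Summits.NavierStokesRegularity.NavierStokesRegularity.Theorems.TaylorModelRungThreeReadoutFlowV
import Summits.NavierStokesRegularity.NavierStokesRegularity.Theorems.TaylorModelRungThreeSoundnessVectorFDeriv
import Summits.NavierStokesRegularity.NavierStokesRegularity.Theorems.TaylorModelRungThreeSoundnessVectorVar

/-!
# Line `taylor-model` on crux K1b-DR (stmt-NavierStokesRegularity-23954) — (E) flow-side consumer of the vector
# step, part 4: the FRÉCHET derivative of the sub-step flow on the start hull and its variational Taylor model
# (the analytic core of the C¹-Lohner object `[M_s]` of PROPAGATE-V-SPEC-cert1 §2 C)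

Setting of parts 1–3 (window coordinates, `flowSel (Qw cd)`); hypotheses explicit and TEST-AGNOSTIC: every start vector of
the hull box `[hlo,hhi]` has a selector trajectory on `[0,h]` inside the tube box `[tlo,thi]` (from (E1) or (E2), parts
1/5 of VECTOR-LEMMAS, at the assembly's choice); the unit-ω variational test (V1) holds on the tube box with
`Ball_j(1) ⊆ [loV,hiV]`; and the order-`p_v+1` VECTOR variational jets are enclosed over tube box × variation box by `JU`.

* `fderiv_flowSel_of_tests` — for `zv` in the hull box and `u ∈ [0,h]`: basis variations `W c` (start `wW c • e_c`) along
  the trajectory from `zv`, confined to `[loV,hiV]`, and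
  `HasFDerivWithinAt (fun yv => flowSel (Qw cd) yv u) (Σ_c (proj c).smulRight ((wW c)⁻¹ • W c u)) (hull box) zv`
  (VECTOR-LEMMAS `hasFDerivWithinAt_flow` — no step restriction) — so Mathlib's chain rule transports the stage derivative
  across sub-steps (C¹-Lohner `G_{s+1} = T_s · G_s`);
* `varTaylor_fderiv_flowSel_of_tests` — the COLUMNS of that derivative obey the variational Taylor model
  `|L e_c c' − Σ_{k≤p_v} varJet (Qw cd) zv e_c k c' · u^k| ≤ JU c' · (wW c)⁻¹ · u^(p_v+1)`, i.e. `DΦ_u(zv) ∈ [M_s(u)]` entrywise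
  once the checker encloses `Σ_k W_k(H)·u^k` by interval jets over the hull (typer's `jetLevelsA`).

MODEL-lattice rung TL-M3 only; nothing here is a statement about the Navier–Stokes equations.
-/

noncomputable section

-- the sub-problem namespace repeats the summit name by design (D-0017)
set_option linter.dupNamespace false

namespace Summit.NavierStokesRegularity.NavierStokesRegularity.Theorems.TaylorModelReadout

open Set Finset
open Literature.Analysis.FluidPDE.TaoCascade Literature.Analysis.FluidPDE.TaoCascade.TaylorChain
open Summit.NavierStokesRegularity.NavierStokesRegularity.Theorems.TaylorModelMajorant
open Summit.NavierStokesRegularity.NavierStokesRegularity.Theorems.TaylorModelVector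

variable {cd : CertData} {j : ℕ} {hlo hhi tlo thi loV hiV JU : Fin 4 → ℤ → ℝ} {h : ℝ} {pv : ℕ}

/-- **Basis variations and the Fréchet derivative of the sub-step flow on the start hull, with the variational
Taylor model of its columns.** [folklore] -/
theorem fderiv_flowSel_of_tests
    (hMS : IsMajorantSystem (nW cd) (Qw cd) (wW cd j) (cd.bb j) (taylorJet (Qw cd)) (varJet (Qw cd)))
    (hω : ∀ k, 0 < cd.ω j k) (hh : 0 ≤ h)
    (hsol : ∀ zv ∈ Icc (toVec cd hlo) (toVec cd hhi),
      IsSolOn (Qw cd) zv h (fun s => flowSel (Qw cd) zv s) ∧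
        ∀ u ∈ Icc 0 h, flowSel (Qw cd) zv u ∈ Icc (toVec cd tlo) (toVec cd thi))
    (hVunit : ∀ i k, -cd.Kb ≤ k → k ≤ cd.Ka → loV i k ≤ -cd.ω j k ∧ cd.ω j k ≤ hiV i k)
    (hencV : ∀ v₀ : Fin 4 → ℤ → ℝ, cd.InBall j v₀ 1 → ∀ y v : Fin 4 → ℤ → ℝ,
      (∀ i k, -cd.Kb ≤ k → k ≤ cd.Ka → tlo i k ≤ y i k ∧ y i k ≤ thi i k) →
      (∀ i k, -cd.Kb ≤ k → k ≤ cd.Ka → loV i k ≤ v i k ∧ v i k ≤ hiV i k) → ∀ u ∈ Icc (0:ℝ) h,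
        ∀ i k, -cd.Kb ≤ k → k ≤ cd.Ka →
          loV i k ≤ (v₀ + u • (cd.Qb y v + cd.Qb v y)) i k ∧ (v₀ + u • (cd.Qb y v + cd.Qb v y)) i k ≤ hiV i k)
    (hJU : ∀ y v : Fin 4 → ℤ → ℝ, (∀ i k, -cd.Kb ≤ k → k ≤ cd.Ka → tlo i k ≤ y i k ∧ y i k ≤ thi i k) →
      (∀ i k, -cd.Kb ≤ k → k ≤ cd.Ka → loV i k ≤ v i k ∧ v i k ≤ hiV i k) →
      ∀ i k, -cd.Kb ≤ k → k ≤ cd.Ka → |varJet cd.Qb y v (pv + 1) i k| ≤ JU i k)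
    {zv : Fin (nW cd) → ℝ} (hzv : zv ∈ Icc (toVec cd hlo) (toVec cd hhi)) {u : ℝ} (hu : u ∈ Icc 0 h) :
    ∃ W : Fin (nW cd) → ℝ → Fin (nW cd) → ℝ,
      (∀ c, W c 0 = wW cd j c • Pi.single c 1) ∧
      (∀ c, ∀ s ∈ Icc 0 h, HasDerivWithinAt (W c)
        (Qw cd (flowSel (Qw cd) zv s) (W c s) + Qw cd (W c s) (flowSel (Qw cd) zv s)) (Icc 0 h) s) ∧
      (∀ c, ∀ s ∈ Icc 0 h, W c s ∈ Icc (toVec cd loV) (toVec cd hiV)) ∧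
      HasFDerivWithinAt (fun yv => flowSel (Qw cd) yv u)
        (∑ c, (ContinuousLinearMap.proj c : (Fin (nW cd) → ℝ) →L[ℝ] ℝ).smulRight ((wW cd j c)⁻¹ • W c u))
        (Icc (toVec cd hlo) (toVec cd hhi)) zv ∧
      (∀ c, ∀ s ∈ Icc 0 h, ∀ c',
        |W c s c' - ∑ k ∈ Finset.range (pv + 1), varJet (Qw cd) zv (wW cd j c • Pi.single c 1) k c' * s ^ k|
          ≤ toVec cd JU c' * s ^ (pv + 1)) := by
  obtain ⟨Qb, hQb⟩ := exists_bundle hMS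
  have hwpos : ∀ c, 0 < wW cd j c := wW_pos cd hω
  -- the (V1) test and the JU enclosure in window coordinates
  have hencV' : ∀ v₀ : Fin (nW cd) → ℝ, (∀ c, |v₀ c| ≤ 1 * wW cd j c) →
      ∀ yv ∈ Icc (toVec cd tlo) (toVec cd thi), ∀ vv ∈ Icc (toVec cd loV) (toVec cd hiV), ∀ u ∈ Icc (0:ℝ) h,
        v₀ + u • (Qb yv vv + Qb vv yv) ∈ Icc (toVec cd loV) (toVec cd hiV) := by
    intro v₀ hv₀ yv hyv vv hvv u hu
    have h1 := hencV (ofVec cd v₀) ((inBall_ofVec_iff cd j v₀ 1).2 hv₀) (ofVec cd yv) (ofVec cd vv)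
      (ofVec_window_bounds (cd := cd) hyv) (ofVec_window_bounds (cd := cd) hvv) u hu
    have h2 := toVec_mem_Icc_of_bounds (cd := cd) h1
    rw [toVec_add, toVec_smul, toVec_add, toVec_ofVec] at h2
    simpa [hQb, Qw] using h2
  have hJU' : ∀ yv ∈ Icc (toVec cd tlo) (toVec cd thi), ∀ vv ∈ Icc (toVec cd loV) (toVec cd hiV), ∀ c',
      |varJet (Qw cd) yv vv (pv + 1) c'| ≤ toVec cd JU c' := by
    intro yv hyv vv hvv c'
    have h1 := hJU (ofVec cd yv) (ofVec cd vv) (ofVec_window_bounds (cd := cd) hyv) (ofVec_window_bounds (cd := cd) hvv)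
      (modeOf cd c') (shellOf cd c') (shellOf_mem cd c').1 (shellOf_mem cd c').2
    have h2 := congrFun (toVec_varJet (cd := cd) (ofVec cd yv) (ofVec cd vv) (pv + 1)) c'
    rw [toVec_ofVec, toVec_ofVec] at h2
    simp only [toVec] at h2 ⊢
    rw [← h2]
    exact h1
  -- basis start directions are unit-ω and lie in the variation box
  have hbasis1 : ∀ c c', |(wW cd j c • (Pi.single c 1 : Fin (nW cd) → ℝ)) c'| ≤ 1 * wW cd j c' := by
    intro c c'
    by_cases hcc : c' = c
    · subst hcc; simp [abs_of_pos (hwpos c')]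
    · simp [Pi.single_eq_of_ne hcc, (hwpos c').le]
  have hbasisV : ∀ c, wW cd j c • (Pi.single c 1 : Fin (nW cd) → ℝ) ∈ Icc (toVec cd loV) (toVec cd hiV) := by
    intro c
    refine ⟨fun c' => ?_, fun c' => ?_⟩
    · have a := (abs_le.1 (hbasis1 c c')).1
      have b := (hVunit (modeOf cd c') (shellOf cd c') (shellOf_mem cd c').1 (shellOf_mem cd c').2).1
      simp only [toVec, wW, one_mul] at a b ⊢; linarith
    · have a := (abs_le.1 (hbasis1 c c')).2
      have b := (hVunit (modeOf cd c') (shellOf cd c') (shellOf_mem cd c').1 (shellOf_mem cd c').2).2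
      simp only [toVec, wW, one_mul] at a b ⊢; linarith
  -- the trajectory from `zv` and the basis variations along it
  obtain ⟨hsolz, hboxz⟩ := hsol zv hzv
  have hψ : ∀ s ∈ Icc 0 h, HasDerivWithinAt (fun s => flowSel (Qw cd) zv s)
      (Qb (flowSel (Qw cd) zv s) (flowSel (Qw cd) zv s)) (Icc 0 h) s := by
    simpa only [hQb] using hsolz.2
  have hcont : ContinuousOn (fun s => flowSel (Qw cd) zv s) (Icc 0 h) := fun s hs => (hψ s hs).continuousWithinAt
  have hW : ∀ c, ∃ V : ℝ → Fin (nW cd) → ℝ, V 0 = wW cd j c • Pi.single c 1 ∧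
      (∀ s ∈ Icc 0 h, HasDerivWithinAt V (Qb (flowSel (Qw cd) zv s) (V s) + Qb (V s) (flowSel (Qw cd) zv s)) (Icc 0 h) s) ∧
      ∀ s ∈ Icc 0 h, V s ∈ Icc (toVec cd loV) (toVec cd hiV) :=
    fun c => exists_var_sol_mem_Icc_along Qb hh hcont hboxz (hbasisV c) (hencV' _ (hbasis1 c))
  choose W hW0 hWder hWbox using hW
  have hTs : ∀ x (k : ℕ) c, ((k : ℝ) + 1) * taylorJet (Qw cd) x (k + 1) c =
      ∑ i ∈ Finset.range (k + 1), Qb (taylorJet (Qw cd) x i) (taylorJet (Qw cd) x (k - i)) c := by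
    simpa only [hQb] using hMS.T_succ
  have hUs : ∀ x v (k : ℕ) c, ((k : ℝ) + 1) * varJet (Qw cd) x v (k + 1) c =
      ∑ i ∈ Finset.range (k + 1), (Qb (taylorJet (Qw cd) x i) (varJet (Qw cd) x v (k - i)) c +
        Qb (varJet (Qw cd) x v (k - i)) (taylorJet (Qw cd) x i) c) := by
    simpa only [hQb] using hMS.U_succ
  refine ⟨W, hW0, fun c s hs => by simpa only [hQb] using hWder c s hs, hWbox, ?_, fun c s hs c' => ?_⟩
  · -- Fréchet derivative within the hull box (every hull trajectory exists and is tube-bounded)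
    refine hasFDerivWithinAt_flow Qb hzv (t := u) (R := max ‖toVec cd tlo‖ ‖toVec cd thi‖) hu.1
      (ψ := fun yv s => flowSel (Qw cd) yv s) (fun yv _ => flowSel_zero _) ?_ ?_ hwpos hW0 ?_
    · intro yv hyv s hs
      have h1 := (isSolOn_restrict (hsol yv hyv).1 hu).2 s hs
      simpa only [hQb] using h1
    · intro yv hyv s hs
      exact norm_le_of_mem_Icc ((hsol yv hyv).2 s ⟨hs.1, hs.2.trans hu.2⟩)
    · intro c s hs
      exact (hWder c s ⟨hs.1, hs.2.trans hu.2⟩).mono (Icc_subset_Icc_right hu.2)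
  · -- variational Taylor model of the basis variation
    have key := abs_sub_varTaylor_le_of_mem_Icc Qb hMS.T_zero hTs hMS.U_zero hUs hψ (hWder c) hboxz (hWbox c)
      hJU' s hs c'
    rw [flowSel_zero, hW0 c] at key
    exact key

/-- **Columns of the sub-step flow derivative obey the variational Taylor model** (the analytic content of
`DΦ_u(z) ∈ [M_s(u)]`, PROPAGATE-V-SPEC §2 C): with `L` the Fréchet derivative of `fderiv_flowSel_of_tests`,
`|L e_c c' − Σ_{k≤p_v} varJet (Qw cd) zv e_c k c' u^k| ≤ JU c' · (wW c)⁻¹ · u^(p_v+1)`. [folklore] -/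
theorem varTaylor_fderiv_flowSel_of_tests
    (hMS : IsMajorantSystem (nW cd) (Qw cd) (wW cd j) (cd.bb j) (taylorJet (Qw cd)) (varJet (Qw cd)))
    (hω : ∀ k, 0 < cd.ω j k) (hh : 0 ≤ h)
    (hsol : ∀ zv ∈ Icc (toVec cd hlo) (toVec cd hhi),
      IsSolOn (Qw cd) zv h (fun s => flowSel (Qw cd) zv s) ∧
        ∀ u ∈ Icc 0 h, flowSel (Qw cd) zv u ∈ Icc (toVec cd tlo) (toVec cd thi))
    (hVunit : ∀ i k, -cd.Kb ≤ k → k ≤ cd.Ka → loV i k ≤ -cd.ω j k ∧ cd.ω j k ≤ hiV i k)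
    (hencV : ∀ v₀ : Fin 4 → ℤ → ℝ, cd.InBall j v₀ 1 → ∀ y v : Fin 4 → ℤ → ℝ,
      (∀ i k, -cd.Kb ≤ k → k ≤ cd.Ka → tlo i k ≤ y i k ∧ y i k ≤ thi i k) →
      (∀ i k, -cd.Kb ≤ k → k ≤ cd.Ka → loV i k ≤ v i k ∧ v i k ≤ hiV i k) → ∀ u ∈ Icc (0:ℝ) h,
        ∀ i k, -cd.Kb ≤ k → k ≤ cd.Ka →
          loV i k ≤ (v₀ + u • (cd.Qb y v + cd.Qb v y)) i k ∧ (v₀ + u • (cd.Qb y v + cd.Qb v y)) i k ≤ hiV i k)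
    (hJU : ∀ y v : Fin 4 → ℤ → ℝ, (∀ i k, -cd.Kb ≤ k → k ≤ cd.Ka → tlo i k ≤ y i k ∧ y i k ≤ thi i k) →
      (∀ i k, -cd.Kb ≤ k → k ≤ cd.Ka → loV i k ≤ v i k ∧ v i k ≤ hiV i k) →
      ∀ i k, -cd.Kb ≤ k → k ≤ cd.Ka → |varJet cd.Qb y v (pv + 1) i k| ≤ JU i k)
    {zv : Fin (nW cd) → ℝ} (hzv : zv ∈ Icc (toVec cd hlo) (toVec cd hhi)) {u : ℝ} (hu : u ∈ Icc 0 h) :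
    ∃ L : (Fin (nW cd) → ℝ) →L[ℝ] (Fin (nW cd) → ℝ),
      HasFDerivWithinAt (fun yv => flowSel (Qw cd) yv u) L (Icc (toVec cd hlo) (toVec cd hhi)) zv ∧
      (∀ c, L (Pi.single c 1) ∈ Icc ((wW cd j c)⁻¹ • toVec cd loV) ((wW cd j c)⁻¹ • toVec cd hiV)) ∧
      ∀ c c', |L (Pi.single c 1) c' - ∑ k ∈ Finset.range (pv + 1), varJet (Qw cd) zv (Pi.single c 1) k c' * u ^ k|
        ≤ toVec cd JU c' * (wW cd j c)⁻¹ * u ^ (pv + 1) := by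
  have hwpos : ∀ c, 0 < wW cd j c := wW_pos cd hω
  obtain ⟨W, hW0, hWder, hWbox, hF, hT⟩ := fderiv_flowSel_of_tests hMS hω hh hsol hVunit hencV hJU hzv hu
  refine ⟨_, hF, fun c => ?_, fun c c' => ?_⟩
  · have hLc : (∑ c'', (ContinuousLinearMap.proj c'' : (Fin (nW cd) → ℝ) →L[ℝ] ℝ).smulRight
        ((wW cd j c'')⁻¹ • W c'' u)) (Pi.single c 1) = (wW cd j c)⁻¹ • W c u := by
      rw [_root_.sum_apply, Finset.sum_eq_single c (fun c'' _ hc => by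
        simp [ContinuousLinearMap.smulRight_apply, Pi.single_eq_of_ne hc]) (fun hc => absurd (Finset.mem_univ c) hc)]
      simp [ContinuousLinearMap.smulRight_apply]
    rw [hLc]
    exact smul_mem_Icc_smul (hWbox c u hu) (inv_nonneg.2 (hwpos c).le)
  · have hLc : (∑ c'', (ContinuousLinearMap.proj c'' : (Fin (nW cd) → ℝ) →L[ℝ] ℝ).smulRight
        ((wW cd j c'')⁻¹ • W c'' u)) (Pi.single c 1) c' = (wW cd j c)⁻¹ * W c u c' := by
      rw [_root_.sum_apply, Finset.sum_eq_single c (fun c'' _ hc => by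
        simp [ContinuousLinearMap.smulRight_apply, Pi.single_eq_of_ne hc]) (fun hc => absurd (Finset.mem_univ c) hc)]
      simp [ContinuousLinearMap.smulRight_apply]
    rw [hLc]
    have h1 := hT c u hu c'
    -- `varJet` is linear in the direction: pull the factor `wW c` out
    have hlin : ∀ k, varJet (Qw cd) zv (wW cd j c • (Pi.single c 1 : Fin (nW cd) → ℝ)) k c' =
        wW cd j c * varJet (Qw cd) zv (Pi.single c 1) k c' := by
      intro k
      have h2 := varJet_smul (Q := Qw cd) (x := zv) (fun r a b => (isLinearMap_Qw_right cd a).map_smul r b)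
        (fun r a b => (isLinearMap_Qw_left cd b).map_smul r a) (wW cd j c) (Pi.single c 1) k
      rw [h2, Pi.smul_apply, smul_eq_mul]
    simp only [hlin] at h1
    have hw0 : (wW cd j c)⁻¹ * wW cd j c = 1 := inv_mul_cancel₀ (hwpos c).ne'
    have e : (wW cd j c)⁻¹ * W c u c' - ∑ k ∈ Finset.range (pv + 1), varJet (Qw cd) zv (Pi.single c 1) k c' * u ^ k
        = (wW cd j c)⁻¹ * (W c u c' - ∑ k ∈ Finset.range (pv + 1), wW cd j c * varJet (Qw cd) zv (Pi.single c 1) k c' * u ^ k) := by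
      rw [mul_sub, Finset.mul_sum]
      congr 1
      refine Finset.sum_congr rfl fun k _ => ?_
      rw [← mul_assoc, ← mul_assoc, hw0, one_mul]
    rw [e, abs_mul, abs_of_pos (inv_pos.2 (hwpos c))]
    calc (wW cd j c)⁻¹ * |W c u c' - ∑ k ∈ Finset.range (pv + 1), wW cd j c * varJet (Qw cd) zv (Pi.single c 1) k c' * u ^ k|
        ≤ (wW cd j c)⁻¹ * (toVec cd JU c' * u ^ (pv + 1)) :=
          mul_le_mul_of_nonneg_left h1 (inv_nonneg.2 (hwpos c).le)
      _ = toVec cd JU c' * (wW cd j c)⁻¹ * u ^ (pv + 1) := by ring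

end Summit.NavierStokesRegularity.NavierStokesRegularity.Theorems.TaylorModelReadout

end
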